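import Summits.BirchSwinnertonDyer.BirchSwinnertonDyer.Theorems.GenusKolyvaginAtTwoPowDvdShaCardAtTwoRTCrossPairTerm
import HarnessLib

/-!
# Route `GenusKolyvaginAtTwo`, crux L_T `PowDvdShaCardAtTwoRT` (stmt-BirchSwinnertonDyer-23299), LINE 18, road (E4) — socket X-ORTH:
# the `ι`-FREE forms (no global map `Sel^{(m²)} → Ш[m]`, hence NO upper-bound input)

Seat `bsd-line-gk2-p4` g20 (WIDTH-5 attach, cell `bsd-f1-sign2`), `--supports` the crux L_T (helper; closes nothing).  THEOREMS ONLY (no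
definition, no named fact, no `sorry`); BSD is not proved by any of this; neither is L_T nor any stub.

WHY.  `…RTCrossPairVanishing` §2 and `…RTCrossPairTerm` §2 are stated — following `CasselsTateSelmerPullback` — along a GLOBAL additive map
`ι : Sel^{(m²)}(E/K) → Ш(E/K)[m]` with `shaTorsionVal ∘ ι = torsionH1ToH1`.  Such a map exists (`exists_selmerToShaTorsion`) only when
`Ш[m²] = Ш[m]`, i.e. when `m` already kills `Ш[p^∞]` — an UPPER-BOUND input, which the LOWER-bound crux L_T must not use (U_T is a sibling crux).
The K-side capstone of road (E4) only ever pairs the images of finitely many Kolyvagin Ш-classes, each of order `≤ 2^{M₀} ≤ m`; so what it needs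
is the same vanishing for ELEMENTS `x, y ∈ Ш[m]` whose underlying `H¹(K, E)`-classes are the images of the Selmer classes `z, t`, and an additive
map into `Ш[m]` defined on a subgroup of `Sel^{(m²)}` whose classes have `m`-torsion image.  This file supplies exactly that:
* `exists_addMonoidHom_shaTorsion` — for an additive subgroup `G ≤ Sel^{(m²)}(E/K)` all of whose classes have `m`-torsion image in `H¹(K, E)`,
  an additive `f : G → Ш[m]` with `shaTorsionVal ∘ f = torsionH1ToH1` (the `f` of `…RTOrthogonalLadders`'
  `pow_two_mul_dvd_natCard_sha_of_orthogonal_ladders_of_dvd_two`); `addMonoidHom_shaTorsion_eq_zero_iff` — its kernel is `ker torsionH1ToH1 ∩ G`.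
* `ctLevelPairing_eq_zero_of_forall_localTerm_eq_zero`, `ctLevelPairing_eq_zero_of_forall_cases` — `…CrossPairVanishing` §2 for elements.
* **`ctLevelPairing_eq_zero_of_opposite_signs`** — X-ORTH FOR ONE PAIR, `ι`-free: `…CrossPairTerm` §2 verbatim for elements `x, y ∈ Ш[m]` over the
  Selmer classes `z = m • k • c` (sign `s`, own places `Sn`) and `t` (sign `−s`, own places `Sn′`).

References: [McCallumLMS1991] §4 Prop. 4.7, §5 Lemma 5.3, Thm. 5.4; [MilneADT2006] I §6 Prop. 6.9 and its proof; [Kolyvagin1991StructureSha].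
-/

set_option autoImplicit false

noncomputable section

open scoped Classical
open scoped AddSubgroup
open Function Field NumberField IsDedekindDomain WeierstrassCurve
open Literature.NumberTheory.EllipticCurves Literature.NumberTheory.GaloisRepresentations
open Literature.NumberTheory.GaloisCohomology
open Literature.NumberTheory.GaloisRepresentations.DiscreteGaloisModule (mu)
open Literature.NumberTheory.Automorphic
open Summit.BirchSwinnertonDyer.Rank1Residual.X11b.Relaxation
open Summit.BirchSwinnertonDyer.Rank1Residual.JET.GlobalDuality

-- the Theorems namespace of this sub repeats the summit name by design (D-0017 nested layout)
set_option linter.dupNamespace false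

universe u

namespace Summit.BirchSwinnertonDyer.BirchSwinnertonDyer.Theorems.GenusExact.PlusDescent

/-! ## §1 Additive maps into `Ш[m]` on subgroups of `Sel^{(m²)}` with `m`-torsion image -/

section ShaTorsionMap

variable {K : Type u} [Field K] [NumberField K] (W : WeierstrassCurve K) (m : ℕ)

/-- **`G → Ш(E/K)[m]`** for an additive subgroup `G` of `Sel^{(m²)}(E/K)` all of whose classes have `m`-torsion image in `H¹(K, E)`: `z ↦` the
image of `z` in `H¹(K, E)` (a class of `Ш`, `torsionH1ToH1_mem_sha_of_mem_selmerGroup`, killed by `m` by hypothesis).  Unlike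
`exists_selmerToShaTorsion` this asks nothing of `Ш` (no `Ш[m²] = Ш[m]`). [cite: MilneADT2006, Ch. I §6, (6.14) and Prop. 6.9]
[cite: SilvermanAEC2009, X.§4 Thm. 4.2] -/
theorem exists_addMonoidHom_shaTorsion [NeZero m] (G : AddSubgroup (galH1Torsion W ((m * m : ℕ) : ℤ)))
    (hG : G ≤ selmerGroup W ((m * m : ℕ) : ℤ))
    (hm : ∀ z ∈ G, (m : ℤ) • torsionH1ToH1 W ((m * m : ℕ) : ℤ) z = 0) :
    ∃ f : G →+ (W.sha)[m], ∀ z : G, shaTorsionVal W m (f z) = torsionH1ToH1 W ((m * m : ℕ) : ℤ) z := by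
  have hn : ((m * m : ℕ) : ℤ) ≠ 0 := Int.natCast_ne_zero.mpr (NeZero.ne (m * m))
  have hmem : ∀ z : G, torsionH1ToH1 W ((m * m : ℕ) : ℤ) z ∈ W.sha := fun z =>
    torsionH1ToH1_mem_sha_of_mem_selmerGroup (W := W) hn (hG z.2)
  have htor : ∀ z : G, (⟨torsionH1ToH1 W ((m * m : ℕ) : ℤ) z, hmem z⟩ : W.sha) ∈ (W.sha)[m] := fun z =>
    mem_torsionBy_sha_of_zsmul_eq_zero W m (hmem z) (hm z z.2)
  refine ⟨AddMonoidHom.mk' (fun z => ⟨⟨torsionH1ToH1 W ((m * m : ℕ) : ℤ) z, hmem z⟩, htor z⟩)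
    (fun z₁ z₂ => Subtype.ext (Subtype.ext ?_)), fun z => rfl⟩
  change torsionH1ToH1 W ((m * m : ℕ) : ℤ) ((z₁ + z₂ : G) : galH1Torsion W ((m * m : ℕ) : ℤ)) =
    torsionH1ToH1 W ((m * m : ℕ) : ℤ) z₁ + torsionH1ToH1 W ((m * m : ℕ) : ℤ) z₂
  rw [AddSubgroup.coe_add, map_add]

variable {W m} in
/-- The kernel of such an `f : G → Ш[m]` is `ker (Sel^{(m²)} → H¹(K, E)) ∩ G`, i.e. (Kummer sequence) the classes of `G` coming from
`E(K)/m²E(K)`. [cite: SilvermanAEC2009, X.§4 Thm. 4.2] -/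
theorem addMonoidHom_shaTorsion_eq_zero_iff {G : AddSubgroup (galH1Torsion W ((m * m : ℕ) : ℤ))} (f : G →+ (W.sha)[m])
    (hf : ∀ z : G, shaTorsionVal W m (f z) = torsionH1ToH1 W ((m * m : ℕ) : ℤ) z) (z : G) :
    f z = 0 ↔ torsionH1ToH1 W ((m * m : ℕ) : ℤ) z = 0 := by
  rw [← hf z]
  constructor
  · intro h
    rw [h]
    rfl
  · intro h
    exact Subtype.ext (Subtype.ext h)

end ShaTorsionMap

/-! ## §2 `B(x, y) = 0` for elements `x, y ∈ Ш[m]` over Selmer classes — the sum of local terms -/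

section Vanishing

variable {K : Type u} [Field K] [NumberField K] {W : WeierstrassCurve K} {m : ℕ} [NeZero m]
variable (e : geomTorsion W ((m * m : ℕ) : ℤ) → geomTorsion W ((m * m : ℕ) : ℤ) → AlgebraicClosure K)
  (hμ : ∀ S T, e S T ^ (m * m) = 1)
  (hadd₁ : ∀ S₁ S₂ T, e (S₁ + S₂) T = e S₁ T * e S₂ T)
  (hadd₂ : ∀ S T₁ T₂, e S (T₁ + T₂) = e S T₁ * e S T₂)
  (hgal : ∀ (σ : absoluteGaloisGroup K) (S T : geomTorsion W ((m * m : ℕ) : ℤ)), σ • e S T = e (σ • S) (σ • T))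
variable (inv : LocalInvariants K (m * m))
-- `hPT'` is the reciprocity predicate `LocalInvariants.SumInvLocalizationEqZero` on `inv`, not a named fact.
variable (halt : ∀ T, e T T = 1) (hPT' : inv.SumInvLocalizationEqZero)
  (hH3 : ∀ c : galoisCohomology (mu K (m * m)) 3,
    (∀ v : Place K, galoisCohomology.localization (mu K (m * m)) v 3 c = 0) → c = 0)
  (hfin : ∀ D : GeneralCaseData W m e hμ hadd₁ hadd₂ hgal, ∃ S : Finset (Place K), ∀ v ∉ S, D.localTerm inv v = 0)

include halt hPT' in
/-- **`B(x, y) = 0` when every local term vanishes** (`ι`-free `ctLevelPairing_pullback_eq_zero_of_forall_localTerm_eq_zero`).  For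
`x, y ∈ Ш[m]` whose `H¹(K, E)`-classes are the images of Selmer classes `z = m • b₁`, `t` at level `m²`, and ANY first-case datum `D` with
`D.b₁ = b₁`, `ι_* D.b′ = t`: if `t_v(D) = 0` on `D.badSet` then the level-`m` Cassels–Tate value `B(x, y)` is `0` (`ctLevelPairing_apply` +
`ctGeneralFun_zsmul_eq_value`). [cite: MilneADT2006, Ch. I §6, proof of Prop. 6.9] [cite: McCallumLMS1991, §4 Prop. 4.7] -/
theorem ctLevelPairing_eq_zero_of_forall_localTerm_eq_zero [W.IsElliptic] (x y : (W.sha)[m]) (z t : selmerGroup W ((m * m : ℕ) : ℤ))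
    (hx : shaTorsionVal W m x = torsionH1ToH1 W ((m * m : ℕ) : ℤ) z) (hy : shaTorsionVal W m y = torsionH1ToH1 W ((m * m : ℕ) : ℤ) t)
    {b₁ : galoisCohomology (W.torsionGaloisModule ((m * m : ℕ) : ℤ)) 1} (hz : (z : galH1Torsion W ((m * m : ℕ) : ℤ)) = (m : ℤ) • b₁)
    (D : FirstCaseData W m) (hD₁ : D.b₁ = b₁)
    (hDt : galoisCohomology.map (inclKD W m m) 1 D.b' = (t : galH1Torsion W ((m * m : ℕ) : ℤ)))
    (h0 : ∀ v ∈ D.badSet, D.localTerm e hμ hadd₁ hadd₂ hgal inv v = 0) :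
    ctLevelPairing W m e hμ hadd₁ hadd₂ hgal inv halt hPT' hH3 hfin x y = 0 := by
  rw [ctLevelPairing_apply, hx, hy, hz, ← hDt, torsionH1ToH1_map_inclKD, ← hD₁, ctGeneralFun_zsmul_eq_value inv halt hPT' D,
    FirstCaseData.value, Finset.sum_eq_zero h0, map_zero]

include halt hPT' in
/-- **McCallum's case split, vanishing form, `ι`-free** (`ctLevelPairing_pullback_eq_zero_of_forall_cases` for elements): at every place either
`loc_v b₁ ∈ 𝓛_v^{(m²)}`, or `loc_v b′ = 0`, or the local term is known to vanish ⟹ `B(x, y) = 0`. [cite: McCallumLMS1991, §4 Prop. 4.7]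
[cite: MilneADT2006, Ch. I §6, proof of Prop. 6.9] -/
theorem ctLevelPairing_eq_zero_of_forall_cases [W.IsElliptic] (x y : (W.sha)[m]) (z t : selmerGroup W ((m * m : ℕ) : ℤ))
    (hx : shaTorsionVal W m x = torsionH1ToH1 W ((m * m : ℕ) : ℤ) z) (hy : shaTorsionVal W m y = torsionH1ToH1 W ((m * m : ℕ) : ℤ) t)
    {b₁ : galoisCohomology (W.torsionGaloisModule ((m * m : ℕ) : ℤ)) 1} (hz : (z : galH1Torsion W ((m * m : ℕ) : ℤ)) = (m : ℤ) • b₁)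
    (D : FirstCaseData W m) (hD₁ : D.b₁ = b₁)
    (hDt : galoisCohomology.map (inclKD W m m) 1 D.b' = (t : galH1Torsion W ((m * m : ℕ) : ℤ)))
    (h : ∀ v : Place K,
      galoisCohomology.res (W.torsionGaloisModule ((m * m : ℕ) : ℤ)) (Place.Completion v) 1 b₁ ∈
          W.kummerLocalConditionAt ((m * m : ℕ) : ℤ) (Place.Completion v) ∨
        galoisCohomology.res (W.torsionGaloisModule (m : ℤ)) (Place.Completion v) 1 D.b' = 0 ∨
          D.localTerm e hμ hadd₁ hadd₂ hgal inv v = 0) :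
    ctLevelPairing W m e hμ hadd₁ hadd₂ hgal inv halt hPT' hH3 hfin x y = 0 := by
  refine ctLevelPairing_eq_zero_of_forall_localTerm_eq_zero e hμ hadd₁ hadd₂ hgal inv halt hPT' hH3 hfin x y z t hx hy hz D hD₁ hDt
    fun v _ ↦ ?_
  rcases h v with h₁ | h₂ | h₃
  · exact D.localTerm_eq_zero_of_res_b₁_mem inv (GeneralCaseData.hiso_of_fact (hgal := hgal) halt) (hD₁ ▸ h₁)
  · exact D.localTerm_eq_zero_of_res_b'_eq_zero inv h₂
  · exact h₃

end Vanishing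

/-! ## §3 X-ORTH for one pair, `ι`-free -/

section Pair

variable (W : WeierstrassCurve ℚ) (K : Type) [Field K] [NumberField K] [W.IsElliptic] [W.IsGloballyMinimal]

/-- **X-ORTH for one pair, `ι`-free** (`ctLevelPairing_pullback_eq_zero_of_opposite_signs` for elements `x, y ∈ Ш(E/K)[m]`).  Frame: `E/ℚ` with
`Δ < 0` over the Heegner field `K` (`τ` = complex conjugation), Cassels–Tate level `m` with `m·m = 2^M`, `1 ≤ M`; `e`, `inv` the Weil pairing /
local invariants at level `m·m` (`e` alternating and lift-equivariant at the cross places, `inv` conj-compatible); `E(K̄)[m]` without non-zero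
`Γ_K`-fixed points.  Data: `x, y ∈ Ш[m]` over Selmer classes `z = m • k • c` and `t` (`m • t = 0`) at level `m²` with OPPOSITE signs
(`τ_*(k•c) = s·(k•c)`, `τ_* t = −(s·t)`); `c` Selmer off the finite set of places `Sn`, `m • loc_q (k•c) = 0` at `q ∈ Sn`; `loc_q t = 0` and
`E[m²] ⊂ E(K_q)` at `q ∈ Sn′`; every `q ∈ Sn ∖ Sn′` a deep inert Kolyvagin place (`ℓ ∈ q`, `M ≤ M(ℓ)`, `FrobEqFrobInfty W K (2^M) ℓ`,
`τ•q = q`).  Then **`B(x, y) = 0`** — the sum of McCallum's local terms, each zero: Kummer off `Sn`, `loc b′ = 0` on `Sn′`, CROSS on `Sn ∖ Sn′`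
(`firstCase_localTerm_eq_zero_of_cross_of_sign_inclKD`).  No map `Sel^{(m²)} → Ш[m]` and no bound on `Ш` is used.
[cite: McCallumLMS1991, §4 Prop. 4.7, §5 Lemma 5.3, Thm. 5.4] [cite: MilneADT2006, Ch. I §6, Prop. 6.9] [cite: Kolyvagin1991StructureSha] -/
theorem ctLevelPairing_eq_zero_of_opposite_signs {m M : ℕ} [NeZero m] [NeZero (m * m)] (hmm : m * m = 2 ^ M)
    (hK : IsImaginaryQuadratic K) (hΔ : W.Δ < 0) (hM : 1 ≤ M) {τ : K ≃ₐ[ℚ] K} (hτ1 : τ ≠ 1) (hττ : τ * τ = 1)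
    (e : (W.baseChange K).geomTorsion ((m * m : ℕ) : ℤ) → (W.baseChange K).geomTorsion ((m * m : ℕ) : ℤ) → AlgebraicClosure K)
    (hμ : ∀ S T, e S T ^ (m * m) = 1)
    (hadd₁ : ∀ S₁ S₂ T, e (S₁ + S₂) T = e S₁ T * e S₂ T)
    (hadd₂ : ∀ S T₁ T₂, e S (T₁ + T₂) = e S T₁ * e S T₂)
    (hgal : ∀ (γ : absoluteGaloisGroup K) (S T : (W.baseChange K).geomTorsion ((m * m : ℕ) : ℤ)), γ • e S T = e (γ • S) (γ • T))
    (halt : ∀ T, e T T = 1)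
    (inv : LocalInvariants K (m * m)) (hinvc : inv.IsConjCompatible τ) (hPT' : inv.SumInvLocalizationEqZero)
    (hH3 : ∀ c₃ : galoisCohomology (DiscreteGaloisModule.mu K (m * m)) 3,
      (∀ v : Place K, galoisCohomology.localization (DiscreteGaloisModule.mu K (m * m)) v 3 c₃ = 0) → c₃ = 0)
    (hfin : ∀ D : GeneralCaseData (W.baseChange K) m e hμ hadd₁ hadd₂ hgal, ∃ S : Finset (Place K), ∀ v ∉ S, D.localTerm inv v = 0)
    (hnofix : ∀ P : geomTorsion (W.baseChange K) (m : ℤ), (∀ g : absoluteGaloisGroup K, g • P = P) → P = 0)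
    (x y : ((W.baseChange K).sha)[m]) (z t : selmerGroup (W.baseChange K) ((m * m : ℕ) : ℤ))
    (hx : shaTorsionVal (W.baseChange K) m x = torsionH1ToH1 (W.baseChange K) ((m * m : ℕ) : ℤ) z)
    (hy : shaTorsionVal (W.baseChange K) m y = torsionH1ToH1 (W.baseChange K) ((m * m : ℕ) : ℤ) t)
    (c : galoisCohomology ((W.baseChange K).torsionGaloisModule ((m * m : ℕ) : ℤ)) 1) (k : ℤ)
    (hz : (z : galH1Torsion (W.baseChange K) ((m * m : ℕ) : ℤ)) = (m : ℤ) • k • c)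
    (hmt : (m : ℤ) • (t : galH1Torsion (W.baseChange K) ((m * m : ℕ) : ℤ)) = 0)
    {s : ℤ} (hsc : conjAct W τ ((m * m : ℕ) : ℤ) (k • c) = s • (k • c))
    (hst : conjAct W τ ((m * m : ℕ) : ℤ) (t : galH1Torsion (W.baseChange K) ((m * m : ℕ) : ℤ)) =
      -(s • (t : galH1Torsion (W.baseChange K) ((m * m : ℕ) : ℤ))))
    (Sn Sn' : Set (HeightOneSpectrum (𝓞 K)))
    (hc : ∀ v : Place K, (∀ q ∈ Sn, v ≠ Sum.inr q) → c ∈ selmerLocalKer (W.baseChange K) (Place.Completion v) ((m * m : ℕ) : ℤ))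
    (hmc : ∀ q ∈ Sn, (m : ℤ) • galoisCohomology.localization ((W.baseChange K).torsionGaloisModule ((m * m : ℕ) : ℤ))
      (Sum.inr q : Place K) 1 (k • c) = 0)
    (ht0 : ∀ q ∈ Sn', galoisCohomology.res ((W.baseChange K).torsionGaloisModule ((m * m : ℕ) : ℤ))
      (Place.Completion (Sum.inr q : Place K)) 1 (t : galH1Torsion (W.baseChange K) ((m * m : ℕ) : ℤ)) = 0)
    (htriv : ∀ q ∈ Sn', ∀ (g : absoluteGaloisGroup (Place.Completion (Sum.inr q : Place K)))
      (Q : geomTorsion (W.baseChange K) ((m * m : ℕ) : ℤ)), absGaloisRestrict K (Place.Completion (Sum.inr q : Place K)) g • Q = Q)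
    (hcross : ∀ q ∈ Sn, q ∉ Sn' → ∃ (ℓ : ℕ) (hfix : τ • q = q), Zhang2014.IsKolyvaginPrime (W.conductorNorm ℤ) W K 2 ℓ ∧
      M ≤ Zhang2014.kolyvaginIndex W 2 ℓ ∧ FrobEqFrobInfty W K (2 ^ M) ℓ ∧ (ℓ : 𝓞 K) ∈ q.asIdeal ∧
      ∀ S T, e ((isLiftOfAut_liftAutPlace τ hfix).torsionMap W ((m * m : ℕ) : ℤ) S)
        ((isLiftOfAut_liftAutPlace τ hfix).torsionMap W ((m * m : ℕ) : ℤ) T) = liftAutPlace τ hfix (e S T)) :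
    ctLevelPairing (W.baseChange K) m e hμ hadd₁ hadd₂ hgal inv halt hPT' hH3 hfin x y = 0 := by
  -- first-case data for the pair
  obtain ⟨D, hD₁, hDt⟩ := exists_firstCaseData_kolyvagin z t c k hz hnofix hmt
  refine ctLevelPairing_eq_zero_of_forall_cases e hμ hadd₁ hadd₂ hgal inv halt hPT' hH3 hfin x y z t hx hy hz D hD₁ hDt fun v ↦ ?_
  by_cases hv' : ∃ q ∈ Sn', v = Sum.inr q
  · -- own place of `t`: `loc_v b′ = 0`
    obtain ⟨q, hq, rfl⟩ := hv'
    exact Or.inr (Or.inl (D.res_b'_eq_zero_of_map_inclKD_eq hDt (ht0 q hq)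
      (map_inclKD_restrictField_injective_of_forall_smul_eq (W.baseChange K) m (Place.Completion (Sum.inr q : Place K)) (htriv q hq))))
  by_cases hv : ∃ q ∈ Sn, v = Sum.inr q
  · -- cross place: `q ∈ Sn ∖ Sn′`
    obtain ⟨q, hq, rfl⟩ := hv
    have hq' : q ∉ Sn' := fun h ↦ hv' ⟨q, h, rfl⟩
    obtain ⟨ℓ, hfix, hℓ, hk, hF, hw, hte⟩ := hcross q hq hq'
    refine Or.inr (Or.inr ?_)
    have hb₁ : conjAct W τ ((m * m : ℕ) : ℤ) D.b₁ = s • D.b₁ := by rw [hD₁]; exact hsc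
    have hmb₁ : (m : ℤ) • galoisCohomology.localization ((W.baseChange K).torsionGaloisModule ((m * m : ℕ) : ℤ))
        (Sum.inr q : Place K) 1 D.b₁ = 0 := by rw [hD₁]; exact hmc q hq
    exact firstCase_localTerm_eq_zero_of_cross_of_sign_inclKD W K hmm hK hΔ hM hℓ hk hF q hw hτ1 hττ hfix e hμ hadd₁ hadd₂ hgal halt
      hte inv hinvc hnofix D hb₁ hmb₁ hDt hst
  · -- `b₁` is Selmer (Kummer) here
    push Not at hv hv'
    refine Or.inl ?_
    have hcv : c ∈ selmerLocalKer (W.baseChange K) (Place.Completion v) ((m * m : ℕ) : ℤ) := hc v fun q hq h ↦ hv q hq h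
    rw [map_zsmul]
    exact AddSubgroup.zsmul_mem _ (mem_kummerLocalConditionAt_res_of_mem_selmerLocalKer (W.baseChange K) _ _ hcv) k

end Pair

end Summit.BirchSwinnertonDyer.BirchSwinnertonDyer.Theorems.GenusExact.PlusDescent

end
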